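import Literature.NumberTheory.EllipticCurves.CastellaWan2024BDPDivisibilityAtTrivialCharacter
import HarnessLib

/-!
# Castella–Wan 2024 Thm. 5.3 ∘ Castella 2018 Thm. 3.2 at the trivial character — the `d_K` ODD restatement
# (cell `bsd-print-x6`, PLAN v4.8 REPAIR (α1); typer seat ty2 standing in for ty1)

Named literature fact (statement-only, D-0014; nothing asserted). This module
SUPERSEDES, for the cell's class-tier booking, the composite
`Literature.NumberTheory.EllipticCurves.castellaWan2024_thm53_castella2018_thm32_constantCoeff` (this topic,
`CastellaWan2024BDPDivisibilityAtTrivialCharacter.lean` :74, p543331) by the SAME statement with ONE extra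
printed hypothesis — `Odd (NumberField.discr K).natAbs`, inserted right after `IsImaginaryQuadratic K` — which
renders the cell referee's second-level provenance rider `Cas18-Thm32-dK-odd@BDP13` (REFEREE.md PA-10/PA-10c,
C-45, R-5.1; `Castella2018/PAdicWaldspurgerFormula.lean` module docstring, flag list): Castella 2018 Thm. 3.2
is PRINTED for every `K` with `p` split and (Heeg), no parity of `d_K` (arXiv:1704.06608 p. 9: "Theorem 3.2.
The following equality holds up to a `p`-adic unit: `L_p(f,𝟙) = (1 − a_p p⁻¹ + ε_p)²·(log_{ω_E} P_K)²`"),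
but BOTH legs of its printed proof ("This follows from [bdp1] and [cas-hsieh1] in the case `p ∤ N` and
[cas-split] in the case `p ∣ N`", ibid.) rest on the computations of Bertolini–Darmon–Prasanna, Duke Math.
J. 162 (2013), printed under their Assumption 5.12 (2)(3) / Thm. 4.6 ("`c` and `d_K` odd"; Rem. 4.7 "for
convenience to simplify the local calculations"), Thm. 5.13 being the trivial-character formula. With the
extra binder the composite quantifies only over the fields the cited proof covers; every other letter,
hypothesis and the conclusion are VERBATIM those of the parity-free decl (see its docstring for the full
page-level transcription of CW24 §2 / Def. 5.1 / (2.2) / Thm. 5.3 and Cas18 §2.1–2.2 / (3.2) / Thm. 3.2,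
and for the composite's own flags `CW24-53+Cas18-32-composite`, `CW24-Cas18-LBDP-identification@CH18` —
discharged on the X6 slice by `X11b.CWFrameValueRigidity` p547864 + `X11b.CW53CompositeOfFrames` p548997,
REF PA-10c/PA-10d — and CW24's `CLW22-addendum`/`Hid04-gap`, re-worded DESCRIPTIVE
`Hid04-density@Ohta26(JMSJ,refereed-in-press)` by REF R-5.1, 2026-08-27). The parity-free decl is the
STRONGER statement, so the one-line monotonicity `…_oddDisc_of_constantCoeff` (PROVED in seat ty2's
`Summits/…/Supersingular/X6RankZeroErratumOddDefs.lean` — the Literature lint keeps uncited lemmas out of this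
folder) feeds every existing consumer's hypothesis into this one; the cell's `Err` road is re-threaded through the odd restatement by seat ty2's pack
`Supersingular.PublishedAcInputsX6ErrOdd` and seat p3's `eisensteinHalfFiveLeErrOdd_of_facts` (PLAN v4.8 (α2)/(α3)).
Where the extra hypothesis is DISCHARGED on the leaf: an erratum-type field with an ODD ramified prime `q`
has `2` split, hence `d_K ≡ 1 (mod 8)` odd (`Supersingular/X6RankZeroErratumPack.lean` §2,
`not_two_dvd_discr_of_two_split`, `X6RankZero.exists_erratumShapeField_oddDiscr_of_oddErratumPrime`, p552208).

References: [CastellaWan2023] Thm. 5.3 (MS pp. 23–24), §2 (MS p. 5), Prop. 2.1 (MS p. 6); [Castella2018]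
Thm. 3.2 with its proof, (3.2), §2.1–2.2 (arXiv:1704.06608 pp. 5, 9); [BertoliniDarmonPrasanna2013]
Assumption 5.12, Thm. 4.6, Rem. 4.7, Thm. 5.13; [CastellaHsieh2018] Def. 3.5; [CastellaLiuWan2022] Thm. 8.2.1 (1).
-/

namespace Literature.NumberTheory.EllipticCurves

open scoped Classical
open WeierstrassCurve NumberField IsDedekindDomain Field Literature.NumberTheory.EllipticCurves

/-- **Castella–Wan 2024 Thm. 5.3 (integral clause vacuous at `N⁻ = 1`) ∘ Castella 2018 Thm. 3.2 at `𝟙`,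
RESTATED OVER IMAGINARY QUADRATIC FIELDS OF ODD DISCRIMINANT** — the statement of
`castellaWan2024_thm53_castella2018_thm32_constantCoeff` VERBATIM (all letters: `W` globally minimal,
`5 ≤ p`, `Good W p`, `Semistable W`, `Irr W p`; `K` imaginary quadratic with (gen-H at `N⁻ = 1`) in the
residue-degree-one form, (ii) a non-split `ℓ ∣ N`, (iii) `¬ 2 ∣ N → 2` splits, (spl); `ι`, `v`, `vbar ∋ p`,
`vbar ≠ v`; `κ` anticyclotomic with generator `γ`; a modular datum `Dt` with `p ∤ Dt.c`, a Heegner datum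
`H` of discriminant `d_K`, `P ↦ P_K` under `ιC`; conclusion: for every `F` with
`char_Λ(X^{rel,str}_{vbar,∅}) = (F)` there is `e : ℤ_p` with
`F(0) = e · ((1 − a_p p⁻¹ + p⁻¹) · log_{ω_E}(P_K))²`) with ONE extra hypothesis, the third binder on `K`:
`Odd (NumberField.discr K).natAbs` — Bertolini–Darmon–Prasanna 2013's standing "`d_K` odd" (Assumption
5.12 / Thm. 4.6 / Rem. 4.7), under which the [bdp1]-leg of Castella 2018's proof of Thm. 3.2 is printed
(Cas18 p. 9: "This follows from [bdp1] and [cas-hsieh1] in the case `p ∤ N`"). COMPOSITE of two printed,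
published theorems, quantified over exactly the fields their printed proofs cover; flags as the parity-free
decl minus `Cas18-Thm32-dK-odd@BDP13` (the referee's tier word is his). Nothing asserted.
[cite: CastellaWan2023, Thm. 5.3 (MS p. 23 L62–p. 24 L2) with §2 (MS p. 5 L27–L37), Def. 5.1 (p. 23), (2.2) (p. 8), Prop. 2.1 (p. 6)]
[cite: Castella2018, Thm. 3.2 with its proof ("follows from [bdp1] and [cas-hsieh1]"), (3.2) and Thm. 3.1 (arXiv:1704.06608 p. 9), §2.1–2.2 (p. 5)]
[cite: BertoliniDarmonPrasanna2013, Assumption 5.12 (2)(3), Thm. 4.6 and Rem. 4.7 ("c and d_K odd"), Thm. 5.13]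
[cite: CastellaLiuWan2022, Thm. 8.2.1 (1) (the source of Thm. 5.3)] [cite: CastellaHsieh2018, Def. 3.5 (the common construction)] -/
def castellaWan2024_thm53_castella2018_thm32_constantCoeff_oddDisc : Prop :=
  ∀ (W : WeierstrassCurve ℚ) [W.IsElliptic] [W.IsGloballyMinimal] (p : ℕ) [Fact p.Prime],
    5 ≤ p → Literature.NumberTheory.EllipticCurves.Rank1Residual.Good W p →
    Literature.NumberTheory.EllipticCurves.Rank1Residual.Semistable W →
    Literature.NumberTheory.EllipticCurves.Rank1Residual.Irr W p →
    ∀ (K : Type) [Field K] [NumberField K],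
      Literature.NumberTheory.EllipticCurves.IsImaginaryQuadratic K →
      Odd (NumberField.discr K).natAbs →
      (∀ ℓ : ℕ, ℓ.Prime → ℓ ∣ W.conductorNorm ℤ →
        ∃ v : IsDedekindDomain.HeightOneSpectrum (𝓞 K), Ideal.absNorm v.asIdeal = ℓ) →
      (∃ ℓ : ℕ, ℓ.Prime ∧ ℓ ∣ W.conductorNorm ℤ ∧
        ((Ideal.span {(ℓ : ℤ)}).primesOver (𝓞 K)).ncard ≠ 2) →
      (¬ 2 ∣ W.conductorNorm ℤ → ((Ideal.span {(2 : ℤ)}).primesOver (𝓞 K)).ncard = 2) →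
      Literature.NumberTheory.EllipticCurves.SatisfiesHeegnerHypothesis p K →
    ∀ (ι : K →+* ℚ_[p]) (v vbar : IsDedekindDomain.HeightOneSpectrum (𝓞 K)),
      (∀ x : 𝓞 K, x ∈ v.asIdeal ↔ ‖ι (x : K)‖ < 1) →
      ((p : ℕ) : 𝓞 K) ∈ vbar.asIdeal → vbar ≠ v →
    ∀ (κ : Literature.NumberTheory.EllipticCurves.ZpExtension K p), κ.IsAnticyclotomic →
    ∀ (γ : Field.absoluteGaloisGroup K) [Fact (κ.IsTopGenerator γ)],
    ∀ (N : ℕ) [NeZero N] (Dt : Literature.NumberTheory.EllipticCurves.ModularForms.ModularParametrizationData W N)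
      (H : Literature.NumberTheory.EllipticCurves.HeegnerDatum N (NumberField.discr K)) (ιC : K →+* ℂ)
      (P : (W.baseChange K).toAffine.Point),
      ¬ (p : ℤ) ∣ Dt.c →
      WeierstrassCurve.Affine.Point.map ιC.toRatAlgHom P =
        Literature.NumberTheory.EllipticCurves.ModularForms.heegnerPointComplex Dt H →
    ∀ F : Literature.NumberTheory.EllipticCurves.IwasawaAlgebra p,
      Literature.NumberTheory.EllipticCurves.Castella2018.AcSelmer.XAc.charIdeal (W.baseChange K) p
          κ vbar ∅ γ = Ideal.span {F} →
      ∃ e : ℤ_[p],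
        ((PowerSeries.constantCoeff F : ℤ_[p]) : ℚ_[p]) =
          (e : ℚ_[p]) *
            ((1 - (W.frobeniusTrace p : ℚ_[p]) * (p : ℚ_[p])⁻¹ + (p : ℚ_[p])⁻¹) *
              ((W.baseChange ℚ_[p]).padicLogPoint
                  (Literature.NumberTheory.EllipticCurves.formalIndex W p •
                    Literature.NumberTheory.EllipticCurves.padicPointOf W p ι P) /
                (Literature.NumberTheory.EllipticCurves.formalIndex W p : ℚ_[p]))) ^ 2


end Literature.NumberTheory.EllipticCurves
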